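import Summits.HodgeConjecture.HodgeConjecture.Theorems.WeilTypeLadder
import Summits.HodgeConjecture.HodgeConjecture.Theses.HeckePrymWeil
import Summits.HodgeConjecture.HodgeConjecture.Theses.PadicSemiregularLift
import Summits.HodgeConjecture.HodgeConjecture.Theses.PeriodDeficiency
import Literature.AlgebraicGeometry.HodgeTheory.AbsoluteHodgeClassesAbelianVarieties
import Literature.AlgebraicGeometry.Motives.AbelianVarietyProjectiveChart
import HarnessLib

/-!
# WeilTypeLadder · the ABSOLUTE-HODGE rung below the floor and the `ℚ̄` / HC(AV) joints of the ladder

b2b cell `hweil` (packet `run/shared/lean/b2b/hodge-weil/`; LADDER.md §3, CLAIM TABLE row P2 (ii); analysis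
`b2b-hweil-pv2/COR-11-2-4.md` §5–6). Prover 2 (variational). HONEST LABEL: the absolute-Hodge statements of
§1 are a rung BELOW the floor — they are THEOREMS in print (Deligne 1982, Main Thm. 2.11) rendered through the
tree's named fact `deligne1982_hodgeClasses_abelianVariety_absoluteHodge`
(`Literature/AlgebraicGeometry/HodgeTheory/AbsoluteHodgeClassesAbelianVarieties.lean`, landed p175530), not
progress above Markman 2025. They record exactly what the variational method DOES prove for every rung of the
conjecture leaf `Theorems/WeilTypeLadder.lean` (p175570): Deligne's family through `A` and `A₀ ⊗ E` plus
Principle B give "absolute Hodge" where Grothendieck's variational Hodge conjecture would give "algebraic"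
(Charles–Schnell 2014, Thm. 11.3.7 and proof of Thm. 11.5.24; COR-11-2-4.md §5).

§2 lands the joints of the ladder with the tree's two standing reductions of the Hodge conjecture for abelian
varieties: the item `PadicSemiregularLift.HodgeAbelianVarieties` (stmt-HodgeConjecture-1333, HC for every
complex abelian variety) implies every rung (one-liners, recorded so that the carver's DAG has the edges), and
— CONDITIONAL on the two refereed named facts Deligne 1982 Thm. 2.11 and Voisin 2007 Prop. 1.2 — the
`ℚ̄`-typed crux `PeriodDeficiency.HodgeConjectureQbar` (stmt-HodgeConjecture-11596) implies
`HodgeAbelianVarieties` (the André-free variant of `Theorems.hodgeAbelianVarieties_of_hodgeConjectureQbar`,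
which goes through André 1996 Thm. 0.6.2 + Prop. 2.5.1 instead), hence every rung and the route target
`HeckePrymWeil.HodgeWeilLadder` (stmt-HodgeConjecture-1259). Serves stmt-1259 without closing it.

Sorry-free; no new definition; hypotheses are named facts (D-0014) or route decls.
-/

-- every declaration of this problem lives in `Summit.HodgeConjecture.HodgeConjecture.…` (summit = sub-problem)
set_option linter.dupNamespace false

noncomputable section

open CategoryTheory

namespace Summit.HodgeConjecture.HodgeConjecture.WeilTypeLadder

open Literature.AlgebraicGeometry Literature.AlgebraicGeometry.Motives
open Literature.AlgebraicGeometry.HodgeTheory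
open Literature.AlgebraicTopology.SingularHomology
open Summit.HodgeConjecture.HodgeConjecture.Theses

/-! ### §1. The absolute-Hodge rung (below the floor): every Weil class of the ladder is absolute Hodge -/

/-- **R∞ in absolute-Hodge form** (Deligne 1982, Thm. 2.11 with Thm. 4.8): in the binders of
`WeilClassesImaginaryQuadratic`, every rational `(n,n)`-class of the Weil plane `weilClassesOf A φ n d` of an
abelian `2n`-fold with `φ ≫ φ = -d` is an ABSOLUTE HODGE class — for every `n ≥ 2`, every `d`, every
discriminant. CONDITIONAL only on the refereed named fact (a theorem in print, not proved in the tree).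
[cite: Deligne1982HodgeCycles, Main Thm. 2.11 (p. 19) and Thm. 4.8 (p. 32)] -/
theorem weilClassesImaginaryQuadratic_absoluteHodge
    (hD : deligne1982_hodgeClasses_abelianVariety_absoluteHodge) :
    ∀ (n : ℕ), 2 ≤ n → ∀ (d : ℕ), 0 < d → ∀ (A : Motives.AbelianVariety ℂ) (φ : A ⟶ A), A.dim = 2 * n →
      Motives.IsSmoothProjective (2 * n) A.X → φ ≫ φ = -(d • 𝟙 A) →
        ∀ c : complexBetti A.X (2 * n), IsRationalClass c → IsOfHodgeType (2 * n) A.X (2 * n) n n c →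
          c ∈ weilClassesOf A φ n d → IsAbsoluteHodgeClass (2 * n) A.X n c :=
  fun _ _ _ _ _ _ hA _ _ _ hcQ hcH hc ↦ isAbsoluteHodgeClass_of_mem_weilClassesOf hD hA hc hcQ hcH

/-- **R3 in absolute-Hodge form** (Deligne 1982, Thm. 2.11; Charles–Schnell, end of the proof of
Thm. 11.5.24: "all split Weil classes on `𝒜_t` are absolute" — here ALL Weil classes): in the binders of
`WeilClassesCMField`, every rational `(m,m)`-class of `weilClassesField A φ P (2m)` (`K = ℚ(φ)` a CM field
of any degree) is an absolute Hodge class. CONDITIONAL only on the refereed named fact.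
[cite: Deligne1982HodgeCycles, Main Thm. 2.11 (p. 19)] [cite: CharlesSchnell2014Notes, Thm. 11.5.1 and proof of Thm. 11.5.24] -/
theorem weilClassesCMField_absoluteHodge (hD : deligne1982_hodgeClasses_abelianVariety_absoluteHodge) :
    ∀ (A : Motives.AbelianVariety ℂ) (φ : A ⟶ A) (P : Polynomial ℤ) (m : ℕ),
      ∀ c ∈ weilClassesField A φ P (2 * m), IsRationalClass c →
        IsOfHodgeType A.dim A.X (2 * m) m m c → IsAbsoluteHodgeClass A.dim A.X m c :=
  fun _ _ _ _ _ hc hcQ hcH ↦ isAbsoluteHodgeClass_of_mem_weilClassesField hD hc hcQ hcH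

/-- **The route target `HeckePrymWeil.HodgeWeilLadder` in absolute-Hodge form**: in the binders of the
target (stmt-HodgeConjecture-1259), every rational `(n,n)`-class of an abelian `2n`-fold with `φ ≫ φ = -p`
is an absolute Hodge class (the eigen-plane hypothesis is not needed: ALL Hodge classes of an abelian
variety are absolute). CONDITIONAL only on the refereed named fact. [cite: Deligne1982HodgeCycles, Main Thm. 2.11 (p. 19) and §6 (p. 43)] -/
theorem hodgeWeilLadder_absoluteHodge (hD : deligne1982_hodgeClasses_abelianVariety_absoluteHodge) :
    ∀ p : ℕ, p.Prime → p % 4 = 3 → 7 ≤ p → ∀ g : ℕ, 2 ≤ g → ∀ n : ℕ, n = (p - 1) / 2 * (g - 1) →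
      ∀ (A : Motives.AbelianVariety ℂ) (φ : A ⟶ A), A.dim = 2 * n → φ ≫ φ = -((p : ℤ) • 𝟙 A) →
        ∀ c : complexBetti A.X (2 * n), IsRationalClass c → IsOfHodgeType (2 * n) A.X (2 * n) n n c →
          IsAbsoluteHodgeClass (2 * n) A.X n c := by
  intro p _ _ _ g _ n _ A φ hA _ c hcQ hcH
  have h1 : IsOfHodgeType A.dim A.X (2 * n) n n c := by rw [hA]; exact hcH
  have h2 := hD A n c hcQ h1
  rw [hA] at h2
  exact h2

/-! ### §2. Joints: HC for abelian varieties (stmt-1333) and HC over `ℚ̄` (stmt-11596) above the ladder -/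

/-- From the Hodge conjecture for every complex abelian variety, a rational `(p,p)`-class on an abelian
variety of dimension `k` (the dimension hypothesis in the rungs' shape `A.dim = k`) is algebraic. [folklore] -/
theorem mem_algebraicClasses_of_hodgeAbelianVarieties (h : PadicSemiregularLift.HodgeAbelianVarieties)
    {A : Motives.AbelianVariety ℂ} {k p : ℕ} (hA : A.dim = k) {c : complexBetti A.X (2 * p)}
    (hcQ : IsRationalClass c) (hcH : IsOfHodgeType k A.X (2 * p) p p c) : c ∈ algebraicClasses A.X p := by
  subst hA
  exact (h A).2 p c hcQ hcH

/-- `HodgeAbelianVarieties → WeilClassesImaginaryQuadratic` (R∞). [folklore] -/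
theorem weilClassesImaginaryQuadratic_of_hodgeAbelianVarieties
    (h : PadicSemiregularLift.HodgeAbelianVarieties) : WeilClassesImaginaryQuadratic :=
  fun _ _ _ _ _ _ hA _ _ _ hcQ hcH _ ↦ mem_algebraicClasses_of_hodgeAbelianVarieties h hA hcQ hcH

/-- `HodgeAbelianVarieties → NonsplitSixfolds` (R1′). [folklore] -/
theorem nonsplitSixfolds_of_hodgeAbelianVarieties (h : PadicSemiregularLift.HodgeAbelianVarieties) :
    NonsplitSixfolds :=
  fun _ _ _ _ hA _ _ _ _ hcQ hcH _ ↦ mem_algebraicClasses_of_hodgeAbelianVarieties h hA hcQ hcH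

/-- `HodgeAbelianVarieties → SplitEightfolds` (R2₈). [folklore] -/
theorem splitEightfolds_of_hodgeAbelianVarieties (h : PadicSemiregularLift.HodgeAbelianVarieties) :
    SplitEightfolds :=
  fun _ _ _ _ hA _ _ _ _ _ _ _ _ hcQ hcH _ ↦ mem_algebraicClasses_of_hodgeAbelianVarieties h hA hcQ hcH

/-- `HodgeAbelianVarieties → SplitWeilAbelianVarieties` (R2). [folklore] -/
theorem splitWeilAbelianVarieties_of_hodgeAbelianVarieties (h : PadicSemiregularLift.HodgeAbelianVarieties) :
    SplitWeilAbelianVarieties :=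
  fun _ _ _ _ _ _ hA _ _ _ _ _ _ _ _ hcQ hcH _ ↦ mem_algebraicClasses_of_hodgeAbelianVarieties h hA hcQ hcH

/-- `HodgeAbelianVarieties → WeilClassesCMField` (R3). [folklore] -/
theorem weilClassesCMField_of_hodgeAbelianVarieties (h : PadicSemiregularLift.HodgeAbelianVarieties) :
    WeilClassesCMField :=
  fun A _ _ _ _ _ _ _ _ _ _ _ _ _ _ hcQ hcH ↦ (h A).2 _ _ hcQ hcH

/-- `HodgeAbelianVarieties → HeckePrymWeil.HodgeWeilLadder` (the route target stmt-HodgeConjecture-1259).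
[folklore] -/
theorem hodgeWeilLadder_of_hodgeAbelianVarieties (h : PadicSemiregularLift.HodgeAbelianVarieties) :
    HeckePrymWeil.HodgeWeilLadder :=
  fun _ _ _ _ _ _ _ _ _ _ hA _ _ hcQ hcH _ ↦ mem_algebraicClasses_of_hodgeAbelianVarieties h hA hcQ hcH

/-- **The `ℚ̄`-reduction, André-free** (CONDITIONAL on Deligne 1982 Thm. 2.11 and Voisin 2007 Prop. 1.2,
both refereed named facts): the Hodge conjecture for all smooth projective complex varieties of the form
`X₀ ×_{ℚ̄,σ} ℂ` (`PeriodDeficiency.HodgeConjectureQbar`, stmt-HodgeConjecture-11596) implies the Hodge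
conjecture for EVERY complex abelian variety (`PadicSemiregularLift.HodgeAbelianVarieties`, stmt-1333).
Compare `Theorems.hodgeAbelianVarieties_of_hodgeConjectureQbar` (same conclusion through André 1996,
Thm. 0.6.2 + Prop. 2.5.1). [cite: Deligne1982HodgeCycles, Main Thm. 2.11 (p. 19)]
[cite: Voisin2007HodgeLoci, Prop. 1.2 and Rem. 1.4] -/
theorem hodgeAbelianVarieties_of_hodgeConjectureQbar_of_deligne
    (hD : deligne1982_hodgeClasses_abelianVariety_absoluteHodge)
    (hV : voisin2007_hodgeConjecture_absolute_of_qbar) (h : PeriodDeficiency.HodgeConjectureQbar) :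
    PadicSemiregularLift.HodgeAbelianVarieties :=
  fun A ↦ hodgeConjectureFor_abelianVariety_of_hodgeConjectureFor_qbar hD hV h A

/-- **Every rung of the Weil-type ladder, and the route target, from the Hodge conjecture over `ℚ̄`**
(CONDITIONAL on Deligne 1982 Thm. 2.11 and Voisin 2007 Prop. 1.2): `HodgeConjectureQbar` ⟹
R∞ ∧ R1′ ∧ R2₈ ∧ R2 ∧ R3 ∧ `HeckePrymWeil.HodgeWeilLadder`. So the whole ladder is dominated by the Hodge
conjecture for varieties definable over `ℚ̄` — the arithmetic shadow of Deligne's theorem.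
[cite: Deligne1982HodgeCycles, Main Thm. 2.11 (p. 19)] [cite: Voisin2007HodgeLoci, Prop. 1.2 and Rem. 1.4] -/
theorem ladder_of_hodgeConjectureQbar_of_deligne
    (hD : deligne1982_hodgeClasses_abelianVariety_absoluteHodge)
    (hV : voisin2007_hodgeConjecture_absolute_of_qbar) (h : PeriodDeficiency.HodgeConjectureQbar) :
    WeilClassesImaginaryQuadratic ∧ NonsplitSixfolds ∧ SplitEightfolds ∧ SplitWeilAbelianVarieties ∧
      WeilClassesCMField ∧ HeckePrymWeil.HodgeWeilLadder :=
  have hAV := hodgeAbelianVarieties_of_hodgeConjectureQbar_of_deligne hD hV h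
  ⟨weilClassesImaginaryQuadratic_of_hodgeAbelianVarieties hAV, nonsplitSixfolds_of_hodgeAbelianVarieties hAV,
    splitEightfolds_of_hodgeAbelianVarieties hAV, splitWeilAbelianVarieties_of_hodgeAbelianVarieties hAV,
    weilClassesCMField_of_hodgeAbelianVarieties hAV, hodgeWeilLadder_of_hodgeAbelianVarieties hAV⟩

end Summit.HodgeConjecture.HodgeConjecture.WeilTypeLadder

end
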